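import Summits.BirchSwinnertonDyer.Rank1Residual.Additive.PotSupersingularTprimeThreeNotCotorsion
import Literature.NumberTheory.EllipticCurves.LegendreFormGoodModelProofs
import HarnessLib

/-!
# A good SUPERSINGULAR model at `v ∋ 3` for every curve with `j = 0` or `ord₃ j > 0` — in
# particular on the WILD class O6 — and its torsion: all `3`-power torsion of `E(K̄_v)` reduces to
# `Õ` (row T-CG-W file F2, cell `b2b-bsdres`, team n1011; seat n1011-p05 GEN 10)

HONEST FRAMING (cell `b2b-bsdres`, run/shared/lean/b2b/bsd-rank1-residual/, verbatim in every
file): the goal of the cell is to DELETE the COMBINATION-SHAPED residual classes of the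
Birch–Swinnerton-Dyer formula for ALL analytic-rank `≤ 1` elliptic curves over `ℚ` — "full BSD
formula for every rank `≤ 1` curve in class `C`" assembled STRICTLY from published theorems — so
that the rank-`≤ 1` remainder becomes exactly the CONSTRUCTION-SHAPED classes, which are TYPED
(missing-input `Prop`s), NOT attempted. This is not "finishing BSD". Team n1011 / class O6 of
RESIDUAL-MAP §I (WILD potentially supersingular additive `3`): research route; TOOL theorems
(a Weierstrass model and its reduction); 0 definitions, 0 named facts; nothing booked, no mark
moves, closes nothing.

## What (`E = W/ℚ` elliptic, `v ∋ p`, `K̄_v = AlgebraicClosure ℚ_v` with the spectral valuation)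

* §1 `exists_goodModel_of_padicValRat_j_nonneg_of_ne_two` — the `p ≠ 2` twin of F-C1's
  `exists_goodModel_of_padicValRat_j_nonneg` (`p ≠ 3`): from `ord_p j ≥ 0` a GOOD MODEL
  `W₀ = C • E ⊗ K̄_v` over the valuation ring `𝒪_w` of `K̄_v`, via the LEGENDRE form
  (`exists_variableChange_eq_baseChange_isUnit_Δ_of_val_j_le_one_of_val_two`, Silverman *AEC*
  VII.5.5 as printed) instead of the Deuring form — so it is available at `p = 3`.
* §2 `exists_goodModel_residue_c₄_eq_zero_three` — at `v ∋ 3`, for `j = 0 ∨ ord₃ j > 0` (which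
  holds on the whole wild cell: the tree's `j_eq_zero_or_padicValRat_j_pos_of_subW_three`), a good
  model with `c̃₄ = 0`, i.e. `j̃ = 0 = 1728` in characteristic `3` — SUPERSINGULAR;
  `forall_mem_kernelOfReduction_of_residue_c₄_eq_zero_three` — for such a model EVERY `3`-power
  torsion point of `E(K̄_v)` lies in the kernel of reduction `Φ_C⁻¹ Ŵ₀(𝔪̄)` (A3c's
  `goodReductionHom_eq_zero_of_pow_smul_eq_zero_of_residue_c₄_eq_zero_three`: `y² = x³ − x` over
  `𝔽₃` is supersingular at every finite level) — the `htors` binder of S1 / F3b;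
  `exists_goodModel_torsion_mem_kernel_three` packages both.

References: J. H. Silverman, *AEC* VII.5.5, V.3.1(a), Ex. V.4.5, VII.2.1 [SilvermanAEC2009];
R. Greenberg, LNM 1716 §2 p. 83 ("`C_v = E[p^∞]` since `Ẽ[p^∞] = 0`") [GreenbergLNM1716];
skeleton `cells/n1011/skel/T-CG-W.md`.
-/

noncomputable section

open scoped Classical NNReal

open WeierstrassCurve

universe u

namespace Summit.BirchSwinnertonDyer.Rank1Residual.Additive.GoodModelLine

open NumberField IsDedekindDomain Field IsDedekindDomain.HeightOneSpectrum
  Literature.NumberTheory.GaloisRepresentations Literature.NumberTheory.EllipticCurves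
  Summit.BirchSwinnertonDyer.Rank1Residual.X2.GreenbergVatsalReductionDatum
  Summit.BirchSwinnertonDyer.Rank1Residual.X2.GreenbergVatsalSelmerLink

variable (W : WeierstrassCurve ℚ) [W.IsElliptic] (p : ℕ) [hp : Fact p.Prime]
  {v : HeightOneSpectrum (𝓞 ℚ)}

/-! ## §1 A good model at `v ∋ p`, `p ≠ 2`, from `ord_p j ≥ 0` (Legendre) -/

/-- **A GOOD MODEL over `𝒪_w ⊂ K̄_v` from `ord_p j ≥ 0`** (`p ≠ 2`): the Legendre good model
`exists_variableChange_eq_baseChange_isUnit_Δ_of_val_j_le_one_of_val_two` (*AEC* VII.5.5 with the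
Legendre form of III.1.7) applied to `E ⊗ K̄_v`; `|2|_v = 1` as `v ∋ p ≠ 2`. The `p ≠ 3` Deuring
twin is F-C1's `exists_goodModel_of_padicValRat_j_nonneg`. [cite: SilvermanAEC2009, Prop. VII.5.5 and Prop. III.1.7] -/
theorem exists_goodModel_of_padicValRat_j_nonneg_of_ne_two (hpv : ((p : ℕ) : 𝓞 ℚ) ∈ v.asIdeal)
    (hp2 : p ≠ 2) (hj : 0 ≤ padicValRat p W.j) :
    ∃ (C : VariableChange (AlgebraicClosure (v.adicCompletion ℚ)))
      (W₀ : WeierstrassCurve (specVal v).integer),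
      C • (W.baseChange (v.adicCompletion ℚ)).baseChange (AlgebraicClosure (v.adicCompletion ℚ)) =
        W₀.baseChange (AlgebraicClosure (v.adicCompletion ℚ)) ∧ IsUnit W₀.Δ := by
  have h2 : specVal v (2 : AlgebraicClosure (v.adicCompletion ℚ)) = 1 := by
    have h := spectralValuation_intCast_eq_one_of_natCast_mem hpv (specVal_spec v) (n := 2)
      (by
        intro h
        have := (Nat.prime_dvd_prime_iff_eq hp.out Nat.prime_two).mp (by exact_mod_cast h)
        exact hp2 this)
    exact_mod_cast h
  have hjX : ((W.baseChange (v.adicCompletion ℚ)).baseChange (AlgebraicClosure (v.adicCompletion ℚ))).j =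
      algebraMap ℚ (AlgebraicClosure (v.adicCompletion ℚ)) W.j := by
    rw [show ((W.baseChange (v.adicCompletion ℚ)).baseChange (AlgebraicClosure (v.adicCompletion ℚ))).j =
        algebraMap (v.adicCompletion ℚ) (AlgebraicClosure (v.adicCompletion ℚ))
          (W.baseChange (v.adicCompletion ℚ)).j from (W.baseChange (v.adicCompletion ℚ)).map_j _,
      show (W.baseChange (v.adicCompletion ℚ)).j = algebraMap ℚ (v.adicCompletion ℚ) W.j from
        W.map_j _, ← IsScalarTower.algebraMap_apply]
  have hjw : specVal v
      ((W.baseChange (v.adicCompletion ℚ)).baseChange (AlgebraicClosure (v.adicCompletion ℚ))).j ≤ 1 := by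
    rw [hjX]
    by_cases hj0 : W.j = 0
    · rw [hj0, map_zero, map_zero]; exact zero_le_one
    · exact (specVal_algebraMap_rat_iff (v := v) W.j).1.mpr
        ((valuation_le_one_iff_padicValRat p hpv hj0).1.mpr hj)
  obtain ⟨C, W₀, hW₀, hΔ⟩ :=
    exists_variableChange_eq_baseChange_isUnit_Δ_of_val_j_le_one_of_val_two h2 _ hjw
  exact ⟨C, W₀, hW₀, hΔ⟩

/-! ## §2 At `v ∋ 3` with `j ≡ 0`: a good SUPERSINGULAR model, all `3`-power torsion reduces to `Õ` -/

/-- **A good model with `j̃ = 0` at `v ∋ 3`** for `E/ℚ` with `j = 0` or `ord₃ j > 0` (the whole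
wild cell `(w)` by `j_eq_zero_or_padicValRat_j_pos_of_subW_three`): §1 at `p = 3` and F-C1's
`residue_c₄_eq_zero_of_goodModel`. In characteristic `3`, `j̃ = 0 = 1728` is the supersingular
`j`-invariant. [cite: SilvermanAEC2009, Prop. VII.5.5, Thm. V.4.1 (c)] -/
theorem exists_goodModel_residue_c₄_eq_zero_three [Fact (Nat.Prime 3)]
    (hpv : ((3 : ℕ) : 𝓞 ℚ) ∈ v.asIdeal) (hj : W.j = 0 ∨ 0 < padicValRat 3 W.j) :
    ∃ (C : VariableChange (AlgebraicClosure (v.adicCompletion ℚ)))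
      (W₀ : WeierstrassCurve (specVal v).integer),
      C • (W.baseChange (v.adicCompletion ℚ)).baseChange (AlgebraicClosure (v.adicCompletion ℚ)) =
        W₀.baseChange (AlgebraicClosure (v.adicCompletion ℚ)) ∧ IsUnit W₀.Δ ∧
      IsLocalRing.residue (specVal v).integer W₀.c₄ = 0 := by
  have hj0 : 0 ≤ padicValRat 3 W.j := by
    rcases hj with h | h
    · rw [h, padicValRat.zero]
    · exact h.le
  obtain ⟨C, W₀, hW₀, hΔ⟩ :=
    exists_goodModel_of_padicValRat_j_nonneg_of_ne_two W 3 hpv (by norm_num) hj0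
  exact ⟨C, W₀, hW₀, hΔ, residue_c₄_eq_zero_of_goodModel W 3 hpv hW₀ hΔ hj⟩

omit [W.IsElliptic] in
/-- **All `3`-power torsion of `E(K̄_v)` lies in the kernel of reduction of a good model with
`c̃₄ = 0` at `v ∋ 3`** (its reduction has `j = 0 = 1728`, SUPERSINGULAR in characteristic `3`:
A3c's `goodReductionHom_eq_zero_of_pow_smul_eq_zero_of_residue_c₄_eq_zero_three`). This is the
`htors` binder of S1 (`GoodModelNoLocalCondition`) and of F3b (`GoodModelNoLocalConditionDescent`).
Greenberg, LNM 1716 p. 83: "`C_v = E[p^∞]` since `Ẽ[p^∞] = 0`".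
[cite: SilvermanAEC2009, Thm. V.3.1 (a), Exercise V.4.5, Prop. VII.2.1] [cite: GreenbergLNM1716, §2 p. 83] -/
theorem forall_mem_kernelOfReduction_of_residue_c₄_eq_zero_three [Fact (Nat.Prime 3)]
    (hpv : ((3 : ℕ) : 𝓞 ℚ) ∈ v.asIdeal) {C : VariableChange (AlgebraicClosure (v.adicCompletion ℚ))}
    {W₀ : WeierstrassCurve (specVal v).integer}
    (hW₀ : C • (W.baseChange (v.adicCompletion ℚ)).baseChange (AlgebraicClosure (v.adicCompletion ℚ)) =
      W₀.baseChange (AlgebraicClosure (v.adicCompletion ℚ))) (hΔ : IsUnit W₀.Δ)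
    (hc₄ : IsLocalRing.residue (specVal v).integer W₀.c₄ = 0) :
    ∀ P : localPoints W (v.adicCompletion ℚ), (∃ k : ℕ, 3 ^ k • P = 0) →
      Affine.Point.congrEquiv hW₀ (VariableChange.pointEquiv _ C
        (Affine.Point.congrEquiv (baseChange_baseChange_adicCompletion W v).symm P)) ∈
        kernelOfReduction W₀ (Valuation.integer.integers (specVal v)) := by
  haveI : CharP (IsLocalRing.ResidueField (specVal v).integer) 3 := charP_residueField_specVal 3 hpv
  rintro P ⟨k, hk⟩
  have hk0 : 3 ^ k •
      (show (W.baseChange (AlgebraicClosure (v.adicCompletion ℚ))).toAffine.Point from P) = 0 := hk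
  refine (mem_kernelOfReduction_iff _).mpr ((goodReductionHom_eq_zero_iff _ hΔ _).mp
    (goodReductionHom_eq_zero_of_pow_smul_eq_zero_of_residue_c₄_eq_zero_three
      (Valuation.integer.integers (specVal v)) hΔ hc₄ _ (n := k) ?_))
  rw [← map_nsmul, ← map_nsmul, ← map_nsmul, hk0, map_zero, map_zero, map_zero]

/-- **O6-ready package**: at `v ∋ 3`, for `E/ℚ` with `j = 0` or `ord₃ j > 0`, a good model
`W₀ = C • E ⊗ K̄_v` over `𝒪_w` (unit discriminant) ALL of whose `3`-power torsion reduces to `Õ`.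
[cite: SilvermanAEC2009, Prop. VII.5.5, Thm. V.3.1 (a), Prop. VII.2.1] [cite: GreenbergLNM1716, §2 p. 83] -/
theorem exists_goodModel_torsion_mem_kernel_three [Fact (Nat.Prime 3)]
    (hpv : ((3 : ℕ) : 𝓞 ℚ) ∈ v.asIdeal) (hj : W.j = 0 ∨ 0 < padicValRat 3 W.j) :
    ∃ (C : VariableChange (AlgebraicClosure (v.adicCompletion ℚ)))
      (W₀ : WeierstrassCurve (specVal v).integer)
      (hW₀ : C • (W.baseChange (v.adicCompletion ℚ)).baseChange (AlgebraicClosure (v.adicCompletion ℚ)) =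
        W₀.baseChange (AlgebraicClosure (v.adicCompletion ℚ))),
      IsUnit W₀.Δ ∧
      ∀ P : localPoints W (v.adicCompletion ℚ), (∃ k : ℕ, 3 ^ k • P = 0) →
        Affine.Point.congrEquiv hW₀ (VariableChange.pointEquiv _ C
          (Affine.Point.congrEquiv (baseChange_baseChange_adicCompletion W v).symm P)) ∈
          kernelOfReduction W₀ (Valuation.integer.integers (specVal v)) := by
  obtain ⟨C, W₀, hW₀, hΔ, hc₄⟩ := exists_goodModel_residue_c₄_eq_zero_three W hpv hj
  exact ⟨C, W₀, hW₀, hΔ, forall_mem_kernelOfReduction_of_residue_c₄_eq_zero_three W hpv hW₀ hΔ hc₄⟩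

end Summit.BirchSwinnertonDyer.Rank1Residual.Additive.GoodModelLine

end
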